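import Mathlib.Computability.Encoding
import Mathlib.Combinatorics.SimpleGraph.Finite
import Mathlib.Logic.Equiv.Fin.Basic
import Mathlib.Data.List.OfFn
import Literature.Computability.Complexity.BoolEncodings
import HarnessLib

-- provenance: harness21/H21/H21/Prelude/CplxCore/GraphEncodings.lean @ 7fd1621 (interim HEAD d8f2665); M5 mechanical rewrite
/-!
# Complexity core: Boolean encodings of finite combinatorial objects

Trunk `CplxCore`, concept C2b (`GraphEncodings`): the string encodings over Cook's alphabet
`{0,1}` of the finite objects appearing in Karp's 21 problems — finite subsets of `Fin n`,
finite simple graphs on `Fin n`, `ℕ`-weighted adjacency matrices (weighted MAX CUT) and sets of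
triples (3-DIMENSIONAL MATCHING). Every `decode_encode` field is proved.

Mathlib provides `Computability.Encoding` and the anchors `SimpleGraph.fromRel`,
`SimpleGraph.fromRel_adj`, `finProdFinEquiv`, `Finset.map_map`,
`Equiv.equiv_toEmbedding_trans_symm_toEmbedding`; it has no encoding of graphs/finsets/matrices
as strings and no "transport an encoding along an equivalence" combinator, so we add

* `Computability.Encoding.ofEquiv` (deliberate dot-notation extension of Mathlib's
  `Computability.Encoding` namespace): transport `Encoding α Γ` along `β ≃ α`;
* `encodingFinVec e m : Encoding (Fin m → α) Bool` (fixed-length vectors via `e.listBool` with a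
  length check);
* `encodingFinsetFin n` (characteristic bit vector), `encodingGraphFin n` / `encodingGraph`
  (row-major adjacency bits, decoded through `SimpleGraph.fromRel`), `encodingNatMatrix`
  (row-major list of weights), `encodingTriples` (characteristic bit vector of length `q³`).

## Design notes

* Universes `α β : Type` (Mathlib's TM2 API is `Type`-monomorphic), as in `BoolEncodings`.
* `encodingGraphFin`/`encodingGraph` are `noncomputable`: the adjacency bits use classical
  decidability of `G.Adj`. Decoding an arbitrary bit matrix goes through `SimpleGraph.fromRel`,
  which symmetrises and deletes the diagonal; on code words this is the identity by `G.symm` and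
  `G.loopless`, which is all `decode_encode` needs.
* Sizes are always paired via `boolPair (encodeNat n) …` (`Computability.Encoding.sigmaBool`),
  never a bare `encodeNat` suffix (`encodeNat 0 = []`).
* Pairs `(i, j) : Fin n × Fin n` are linearised row-major by `finProdFinEquiv`, triples by
  `finTripleEquiv q : Fin q × Fin q × Fin q ≃ Fin (q * (q * q))`.

## References

* R. M. Karp, *Reducibility among combinatorial problems*, 1972, §3 (problem list; graphs,
  families of sets and matchings given "in any natural encoding").
* S. Arora, B. Barak, *Computational Complexity: A Modern Approach*, CUP 2009, §0.1
  ("Representing objects as strings": graphs as adjacency matrices).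
* M. R. Garey, D. S. Johnson, *Computers and Intractability*, 1979, §2.1 (encoding schemes).
-/

namespace Computability.Encoding

variable {α β Γ : Type}

/-- Transport of an encoding along an equivalence: encode `b : β` as the code of `f b : α`,
decode and map back with `f.symm`. Deliberate dot-notation extension of Mathlib's
`Computability.Encoding`. [Garey–Johnson 1979, §2.1 (equivalent encoding schemes)] [cite: GareyJohnson1979, §2.1 (equivalent encoding schemes] -/
def ofEquiv (e : Encoding α Γ) (f : β ≃ α) : Encoding β Γ where
  encode b := e.encode (f b)
  decode w := (e.decode w).map f.symm
  decode_encode b := by simp [e.decode_encode]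

/-- Unfolding lemma for `ofEquiv`. [H21 design C2b] [folklore] -/
@[simp] theorem ofEquiv_encode (e : Encoding α Γ) (f : β ≃ α) (b : β) :
    (e.ofEquiv f).encode b = e.encode (f b) := rfl

end Computability.Encoding

namespace Literature.Computability.Complexity

open _root_.Computability

variable {α : Type}

/-! ### Fixed-length vectors and finite subsets of `Fin n` -/

/-- Vectors `Fin m → α` over `Bool`: the list `List.ofFn v` encoded with `e.listBool`;
decoding checks the length. [Arora–Barak 2009, §0.1 (tuples of strings)] [cite: AroraBarak2009, §0.1 (tuples of strings] -/
def encodingFinVec (e : Encoding α Bool) (m : ℕ) : Encoding (Fin m → α) Bool where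
  encode v := e.listBool.encode (List.ofFn v)
  decode w := (e.listBool.decode w).bind fun l =>
    if h : l.length = m then some (fun i => l.get (i.cast h.symm)) else none
  decode_encode v := by
    rw [e.listBool.decode_encode]
    simp only [Option.bind_some, List.length_ofFn, dite_true, Option.some.injEq]
    funext i
    simp

/-- Finite subsets of `Fin n` over `Bool`: the characteristic bit vector of length `n`,
`s ↦ [0 ∈ s][1 ∈ s]⋯[n-1 ∈ s]`. Decoding reads bit `i` (missing bits count as `0`), so every
string decodes; only `decode_encode` matters. [Karp 1972, §3; Arora–Barak 2009, §0.1] [cite: Karp1972, §3] -/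
def encodingFinsetFin (n : ℕ) : Encoding (Finset (Fin n)) Bool where
  encode s := List.ofFn fun i : Fin n => decide (i ∈ s)
  decode w := some (Finset.univ.filter fun i : Fin n => w.getD i false)
  decode_encode s := by
    simp only [Option.some.injEq]
    ext i
    simp [List.getD_eq_getElem?_getD]

/-- Unfolding lemma for `encodingFinsetFin`. [H21 design C2b] [folklore] -/
@[simp] theorem encodingFinsetFin_encode (n : ℕ) (s : Finset (Fin n)) :
    (encodingFinsetFin n).encode s = List.ofFn fun i : Fin n => decide (i ∈ s) := rfl

/-! ### Simple graphs -/

/-- Simple graphs on `Fin n` (fixed `n`) over `Bool`: the row-major adjacency matrix as a bit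
vector of length `n * n` (bit `finProdFinEquiv (i, j)` is `[G.Adj i j]`, classical
decidability), via `encodingBitVec`; an arbitrary bit matrix is decoded to
`SimpleGraph.fromRel` of the relation it describes (symmetrised, diagonal removed).
Noncomputable. [Arora–Barak 2009, §0.1 (adjacency-matrix representation); Karp 1972, §3] [cite: AroraBarak2009, §0.1 (adjacency-matrix representation] -/
noncomputable def encodingGraphFin (n : ℕ) : Encoding (SimpleGraph (Fin n)) Bool where
  encode G := by
    classical
    exact (encodingBitVec (n * n)).encode fun k =>
      decide (G.Adj (finProdFinEquiv.symm k).1 (finProdFinEquiv.symm k).2)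
  decode w := ((encodingBitVec (n * n)).decode w).map fun f =>
    SimpleGraph.fromRel fun i j : Fin n => f (finProdFinEquiv (i, j)) = true
  decode_encode G := by
    classical
    rw [(encodingBitVec (n * n)).decode_encode]
    simp only [Option.map_some, Option.some.injEq]
    ext i j
    simp only [SimpleGraph.fromRel_adj, Equiv.symm_apply_apply, decide_eq_true_eq]
    constructor
    · rintro ⟨-, h | h⟩
      · exact h
      · exact h.symm
    · intro h
      exact ⟨h.ne, Or.inl h⟩

/-- Finite simple graphs `⟨n, G⟩` (vertex set `Fin n`) over `Bool`:
`boolPair (encodeNat n) (adjacency bits of G)`, i.e. `sigmaBool encodingGraphFin`.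
Noncomputable. [Karp 1972, §3 (CLIQUE, NODE COVER, HAMILTON CIRCUIT, COLORING, …);
Arora–Barak 2009, §0.1] [cite: Karp1972, §3 (CLIQUE  NODE COVER  HAMILTON CIRCUIT] -/
noncomputable def encodingGraph : Encoding (Σ n, SimpleGraph (Fin n)) Bool :=
  Encoding.sigmaBool encodingGraphFin

/-- Unfolding lemma: the code of `⟨n, G⟩` is the pair of `encodeNat n` and the adjacency
bits. [H21 design C2b] [folklore] -/
theorem encodingGraph_encode (p : Σ n, SimpleGraph (Fin n)) :
    encodingGraph.encode p = boolPair (encodeNat p.1) ((encodingGraphFin p.1).encode p.2) := rfl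

/-! ### Weighted adjacency matrices -/

/-- Square `ℕ`-matrices `Fin n → Fin n → ℕ` (fixed `n`) over `Bool`: the row-major list of the
`n * n` entries in binary (`encodingFinVec encodingNatBool (n * n)`), transported along
currying and `finProdFinEquiv`. [Karp 1972, §3 (weighted problems); Arora–Barak 2009, §0.1] [cite: Karp1972, §3 (weighted problems] -/
def encodingNatMatrixFin (n : ℕ) : Encoding (Fin n → Fin n → ℕ) Bool :=
  (encodingFinVec encodingNatBool (n * n)).ofEquiv
    ((Equiv.curry (Fin n) (Fin n) ℕ).symm.trans (finProdFinEquiv.arrowCongr (Equiv.refl ℕ)))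

/-- `ℕ`-weighted graphs `⟨n, w⟩` with `w : Fin n → Fin n → ℕ` (instances of weighted MAX CUT)
over `Bool`: `boolPair (encodeNat n) (row-major entries)`, i.e.
`sigmaBool encodingNatMatrixFin`. [Karp 1972, §3, problem 21 (MAX CUT); Arora–Barak 2009,
§0.1] [cite: Karp1972, §3  problem 21 (MAX CUT] -/
def encodingNatMatrix : Encoding (Σ n, Fin n → Fin n → ℕ) Bool :=
  Encoding.sigmaBool encodingNatMatrixFin

/-- Unfolding lemma for `encodingNatMatrix`. [H21 design C2b] [folklore] -/
theorem encodingNatMatrix_encode (p : Σ n, Fin n → Fin n → ℕ) :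
    encodingNatMatrix.encode p =
      boolPair (encodeNat p.1) ((encodingNatMatrixFin p.1).encode p.2) := rfl

/-! ### Sets of triples (3-dimensional matching) -/

/-- Row-major linearisation of triples, `Fin q × Fin q × Fin q ≃ Fin (q * (q * q))`
(`finProdFinEquiv` twice). [Arora–Barak 2009, §0.1] [cite: AroraBarak2009, §0.1] -/
def finTripleEquiv (q : ℕ) : Fin q × Fin q × Fin q ≃ Fin (q * (q * q)) :=
  (Equiv.prodCongr (Equiv.refl (Fin q)) finProdFinEquiv).trans finProdFinEquiv

/-- Sets of triples `M ⊆ Fin q × Fin q × Fin q` (fixed `q`) over `Bool`: the characteristic bit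
vector of length `q³`, indexed by `finTripleEquiv q` (`encodingFinsetFin` transported along
`Finset.mapEquiv`). [Karp 1972, §3, problem 17 (3-DIMENSIONAL MATCHING)] [cite: Karp1972, §3  problem 17 (3-DIMENSIONAL MATCHING] -/
def encodingTriplesFin (q : ℕ) : Encoding (Finset (Fin q × Fin q × Fin q)) Bool :=
  (encodingFinsetFin (q * (q * q))).ofEquiv (finTripleEquiv q).finsetCongr

/-- 3-dimensional matching instances `⟨q, M⟩`, `M ⊆ Fin q × Fin q × Fin q`, over `Bool`:
`boolPair (encodeNat q) (characteristic bits of M)`, i.e. `sigmaBool encodingTriplesFin`.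
[Karp 1972, §3, problem 17 (3-DIMENSIONAL MATCHING); Garey–Johnson 1979, §3.1.2] [cite: Karp1972, §3  problem 17 (3-DIMENSIONAL MATCHING] -/
def encodingTriples : Encoding (Σ q, Finset (Fin q × Fin q × Fin q)) Bool :=
  Encoding.sigmaBool encodingTriplesFin

/-- Unfolding lemma for `encodingTriples`. [H21 design C2b] [folklore] -/
theorem encodingTriples_encode (p : Σ q, Finset (Fin q × Fin q × Fin q)) :
    encodingTriples.encode p =
      boolPair (encodeNat p.1) ((encodingTriplesFin p.1).encode p.2) := rfl

end Literature.Computability.Complexity
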